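import Literature.MathematicalPhysics.QuantumLattice.Phi4WickDeviation
import Literature.Probability.LatticeModels.TreeGraphWickPairInteraction
import Literature.Probability.LatticeModels.GriffithsMonotonicity
import HarnessLib

/-!
# The tree diagram bound for the lattice `φ⁴` model (via the Griffiths–Simon approximation)

Proofs-only file (topic `Literature/MathematicalPhysics/QuantumLattice`; theorems only, no
definition, no named fact). Aizenman's tree diagram bound
`|U₄(x₁,…,x₄)| ≤ 2∑_z ∏ⱼ⟨σ_{xⱼ}σ_z⟩` (Aizenman 1982, Prop. 5.3), PROVED in the tree for general
ferromagnetic pair interactions on finite sets (`abs_ursell_ratio_le`,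
`WeightedTreeBoundCorrelations`; Panis 2023, §4.2), is moved to the lattice `φ⁴` measures along the
programme of Aizenman–Duminil-Copin 2021, §7 (p. 28: "we identify `⟨·⟩_{ρ,β}` with the Ising measure,
and `τₓ` with the proper average of Ising's variables … the basic diagrammatic bounds which are
available for the Ising model extend to the GS class essentially by linearity, and then … by
continuity"), for a FIXED `φ⁴` law, where the Simon–Griffiths scaling makes the constant explicit:

  **`phi4_treeDiagramBound`**: for `g > 0`, real `κ`, `J ≥ 0`, any finite graph and any four sites,
  `|U₄^{g,κ,J}(x₁,x₂,x₃,x₄)| ≤ 24 g ∑_z ∏ⱼ ⟨φ_{xⱼ}φ_z⟩_{g,κ,J}`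

(`U₄ = connectedFour`, the measure `phi4Measure G g κ J ∝ e^{-∑(gφ⁴+κφ²)+J∑_{xy}φ_xφ_y}∏dφ`). This is
the form of the first-order skeleton inequality of Brydges–Fröhlich–Sokal 1983 for lattice `φ⁴`
(`0 ≥ u₄ ≥ -(const·g)∑_z∏S`); the constant `24 g = 2 · (12 g)` here is `2` (Aizenman's) times the
Simon–Griffiths normalisation `N⁻³w⁻⁴ = scale(g)⁻⁴ = 12 g` of the Curie–Weiss blocks
(`SimonGriffiths.scale_pow_four`). As Aizenman–Duminil-Copin stress (§7.1), this plain transfer is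
not dimensionally balanced — the constant depends on the single-site law through `g` — which is
harmless for a fixed `(g, κ)`.

## Proof

1. `PairIsing.abs_ursellFour_le_treeSum` — the tree diagram bound for `PairIsing.ursellFour c u`
   (coincident points allowed), from `abs_ursell_ratio_le` and `PairIsing.avg_spinProduct_eq_ratio`
   (`σ_aσ_b = σ_{{a}Δ{b}}`, `σ_{u₀}σ_{u₁}σ_{u₂}σ_{u₃} = σ_{{u₀}Δ{u₁}Δ{u₂}Δ{u₃}}`).
2. `PairIsing.avg_comp_perm` — relabelling invariance of pair-interaction averages; hence for block
   systems on `V × Fin N` with CONSTANT intra-block coupling and CONSTANT block weight, the mixed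
   correlation `⟨τ_x σ_{(z,l)}⟩` does not depend on `l` (`block_avg_prod_mul_spinAt_eq`).
3. `block_abs_ursell_le` — for such block variables `τₓ = w∑_l σ_{(x,l)}`:
   `|U₄^τ(u)| ≤ 2 N⁻³w⁻⁴ ∑_z ∏ⱼ S^τ(uⱼ,z)` (multilinearity `PairIsing.block_ursell_eq_sum`, Lebowitz'
   sign `PairIsing.abs_sum_prod_mul_ursellFour`, step 1 on the constituent spins, and step 2).
4. `exists_uniformBlockIsing_tendsto_integral_phi4Measure` — the Simon–Griffiths approximants of
   `isIsingLimitLaw_phi4_holds` made explicit (`N = M⁴` spins, coupling `γ/M⁴`, weight `scale(g)/M³`),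
   for which `N⁻³w⁻⁴ = 12 g`; `blockIsing_treeDiagramBound`; and the limit
   (`tendsto_integral_latticeFieldMeasure`): **`phi4_treeDiagramBound`**.
5. `phi4Free_treeDiagramBound`, `phi4Box_treeDiagramBound` — the free-boundary volumes of `ℤᵈ`
   (`phi4FreeMeasure`, `phi4BoxMeasure`, `phi4TwoPointIn`, `phi4TwoPointBox`: the objects of the
   hypothesis `hU` of `phi44_triviality_of_ursellFourSum` / `phi4_highDim_triviality_of_ursellFourSum`),
   and the summed form `phi4Box_ursellFourSum_le_treeSum`:
   `∑_{u ∈ Λ'⁴} |U₄^R(u)| ≤ 24 g ∑_{z ∈ Λ_R} (∑_{x ∈ Λ'} S₂^R(x,z))⁴` for `Λ' ⊆ Λ_R`.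

## References

* M. Aizenman, *Geometric analysis of `φ⁴` fields and Ising models I, II*, Comm. Math. Phys. 86
  (1982) 1–48, Prop. 5.3 (tree diagram bound), §11–12 (`φ⁴` fields). [AizenmanCMP1982]
* M. Aizenman, H. Duminil-Copin, Ann. of Math. 194 (2021), §7 p. 28 and §7.1. [AizenmanDuminilCopinAnnals2021]
* D. Brydges, J. Fröhlich, A. Sokal, Comm. Math. Phys. 91 (1983) 141–186 (skeleton inequalities).
  [BrydgesFrohlichSokal1983]
* B. Simon, R. Griffiths, Comm. Math. Phys. 33 (1973) 145–164, §2 Thm. 1. [SimonGriffiths1973]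
* R. Panis, arXiv:2309.05797 (2023), §4.2. [Panis2023Triviality]
-/

noncomputable section

open MeasureTheory Filter Topology Finset
open scoped symmDiff

namespace Literature.MathematicalPhysics.QuantumLattice

open Literature.Probability.LatticeModels

/-! ### Part 1. The tree diagram bound for pair-interaction Ising models, `ursellFour` form -/

section PairTree

variable {ι : Type*} [Fintype ι] [DecidableEq ι]

-- `σ_aσ_b = σ_{{a}Δ{b}}` as observables is `spinPair_eq_spinProduct_singleton_symmDiff`
-- (`Literature.Probability.LatticeModels.LebowitzInequality`), used directly below.

omit [Fintype ι] in
/-- `σ_{u₀}σ_{u₁}σ_{u₂}σ_{u₃} = σ_{{u₀}Δ({u₁}Δ({u₂}Δ{u₃}))}` as observables. [folklore] -/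
theorem monomialFour_eq_spinProduct_symmDiff (u : Fin 4 → ι) :
    spinMonomial u = spinProduct (({u 0} : Finset ι) ∆ ({u 1} ∆ ({u 2} ∆ {u 3}))) := by
  funext s
  rw [spinMonomial, Fin.prod_univ_four, ← spinProduct_mul_spinProduct, ← spinProduct_mul_spinProduct,
    ← spinProduct_mul_spinProduct, spinProduct_singleton, spinProduct_singleton,
    spinProduct_singleton, spinProduct_singleton]
  ring

/-- **The tree diagram bound for a general ferromagnetic pair interaction, `ursellFour` form**
(Aizenman 1982, Prop. 5.3; Panis 2023, §4.2; the tree's `abs_ursell_ratio_le` through the dictionary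
`PairIsing.avg_spinProduct_eq_ratio`): for couplings `c ≥ 0` on a finite set and any four points
(coincidences allowed), `|U₄^c(u)| ≤ 2∑_v ∏ⱼ ⟨σ_{uⱼ}σ_v⟩_c`. [cite: AizenmanCMP1982, Prop. 5.3] -/
theorem PairIsing.abs_ursellFour_le_treeSum (c : ι → ι → ℝ) (hc : ∀ a b, 0 ≤ c a b)
    (u : Fin 4 → ι) :
    |PairIsing.ursellFour c u| ≤ 2 * ∑ v, ∏ j, PairIsing.avg c (spinPair (u j) v) := by
  have key := abs_ursell_ratio_le (G := (⊤ : SimpleGraph ι)) (K := pairEdgeWeight c 2)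
    (pairEdgeWeight_nonneg (by norm_num) hc) (u 0) (u 1) (u 2) (u 3)
  have hE : ∀ A : Finset ι, wcurrentSum (pairEdgeWeight c 2) A / wcurrentSum (pairEdgeWeight c 2) ∅ =
      PairIsing.avg c (spinProduct A) := fun A => (PairIsing.avg_spinProduct_eq_ratio c hc A).symm
  have hP : ∀ a b : ι, PairIsing.avg c (spinProduct (({a} : Finset ι) ∆ {b})) =
      PairIsing.avg c (spinPair a b) := fun a b => by rw [spinPair_eq_spinProduct_singleton_symmDiff]
  simp only [hE, hP, ← monomialFour_eq_spinProduct_symmDiff] at key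
  rw [PairIsing.ursellFour_def]
  simpa only [Fin.prod_univ_four, mul_assoc] using key

/-- **Relabelling invariance of pair-interaction averages**: if the couplings are invariant under a
permutation `π` of the sites, then `⟨f(σ ∘ π)⟩_c = ⟨f⟩_c`. [folklore] -/
theorem PairIsing.avg_comp_perm (c : ι → ι → ℝ) (π : Equiv.Perm ι)
    (hc : ∀ a b, c (π a) (π b) = c a b) (f : SpinConfig ι → ℝ) :
    PairIsing.avg c (fun ρ => f (ρ ∘ π)) = PairIsing.avg c f := by
  have hw : ∀ ρ : SpinConfig ι, PairIsing.weight c (ρ ∘ π) = PairIsing.weight c ρ := by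
    intro ρ
    unfold PairIsing.weight
    congr 1
    have hsp : ∀ a, spinAt a (ρ ∘ π) = spinAt (π a) ρ := fun a => rfl
    simp_rw [hsp]
    -- reindex both sums by `π`
    rw [← Equiv.sum_comp π.symm]
    refine Finset.sum_congr rfl fun a _ => ?_
    rw [← Equiv.sum_comp π.symm]
    refine Finset.sum_congr rfl fun b _ => ?_
    rw [Equiv.apply_symm_apply, Equiv.apply_symm_apply]
    have := hc (π.symm a) (π.symm b)
    rw [Equiv.apply_symm_apply, Equiv.apply_symm_apply] at this
    rw [this]
  set e : SpinConfig ι ≃ SpinConfig ι := Equiv.arrowCongr π.symm (Equiv.refl ℤˣ) with he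
  have he' : ∀ ρ : SpinConfig ι, e ρ = ρ ∘ π := fun ρ => by
    rw [he]
    funext a
    simp [Equiv.arrowCongr_apply]
  unfold PairIsing.avg
  congr 1
  rw [← Equiv.sum_comp e (fun ρ => f ρ * PairIsing.weight c ρ)]
  refine Finset.sum_congr rfl fun ρ _ => ?_
  rw [he', hw]

end PairTree

/-! ### Part 2. Block variables with constant intra-block coupling and weight -/

section Blocks

variable {V : Type} [Fintype V] [DecidableEq V] (G : SimpleGraph V) [DecidableRel G.Adj] {N : ℕ}

omit [Fintype V] in
/-- The block couplings on `V × Fin N` with constant intra-block coupling `k₀` and block weight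
`w₀` are invariant under any permutation of the constituents of one block. [folklore] -/
theorem blockCoupling_comp_perm (k₀ w₀ J : ℝ) (z : V) (π₀ : Equiv.Perm (Fin N))
    (a b : V × Fin N) :
    (fun a b : V × Fin N => (if a.1 = b.1 then k₀ else (0 : ℝ)) +
        (if G.Adj a.1 b.1 then J / 2 * (w₀ * w₀) else 0))
      ((Equiv.prodCongrRight fun v : V => if v = z then π₀ else Equiv.refl (Fin N)) a)
      ((Equiv.prodCongrRight fun v : V => if v = z then π₀ else Equiv.refl (Fin N)) b) =
    (fun a b : V × Fin N => (if a.1 = b.1 then k₀ else (0 : ℝ)) +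
        (if G.Adj a.1 b.1 then J / 2 * (w₀ * w₀) else 0)) a b := by
  obtain ⟨a₁, a₂⟩ := a
  obtain ⟨b₁, b₂⟩ := b
  rfl

/-- **`⟨(∏ᵢ τ_{yᵢ}) σ_{(z,l)}⟩` does not depend on the constituent `l`** for block variables
`τₓ = w₀∑_L σ_{(x,L)}` with constant intra-block coupling and weight (relabelling the constituents
of the block `z`). [folklore] -/
theorem block_avg_prod_mul_spinAt_eq (k₀ w₀ J : ℝ) (z : V) (l l' : Fin N) {m : ℕ} (y : Fin m → V) :
    PairIsing.avg (fun a b : V × Fin N => (if a.1 = b.1 then k₀ else (0 : ℝ)) +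
        (if G.Adj a.1 b.1 then J / 2 * (w₀ * w₀) else 0))
      (fun ρ => (∏ i, ∑ L, w₀ * (spinAt (y i, L) ρ : ℝ)) * spinAt (z, l) ρ) =
    PairIsing.avg (fun a b : V × Fin N => (if a.1 = b.1 then k₀ else (0 : ℝ)) +
        (if G.Adj a.1 b.1 then J / 2 * (w₀ * w₀) else 0))
      (fun ρ => (∏ i, ∑ L, w₀ * (spinAt (y i, L) ρ : ℝ)) * spinAt (z, l') ρ) := by
  set π₀ : Equiv.Perm (Fin N) := Equiv.swap l' l with hπ₀
  set π : Equiv.Perm (V × Fin N) :=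
    Equiv.prodCongrRight fun v : V => if v = z then π₀ else Equiv.refl (Fin N) with hπ
  rw [← PairIsing.avg_comp_perm _ π (blockCoupling_comp_perm G k₀ w₀ J z π₀)]
  congr 1
  funext ρ
  have hsp : ∀ a : V × Fin N, spinAt a (ρ ∘ π) = spinAt (π a) ρ := fun a => rfl
  simp only [hsp]
  congr 1
  · refine Finset.prod_congr rfl fun i _ => ?_
    simp only [hπ, Equiv.prodCongrRight_apply]
    by_cases hy : y i = z
    · rw [if_pos hy]
      exact Equiv.sum_comp π₀ (fun L => w₀ * (spinAt (y i, L) ρ : ℝ))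
    · rw [if_neg hy]
      rfl
  · simp [hπ, hπ₀]

/-- **The tree diagram bound for block variables**: on `V × Fin N` (`0 < N`) with constant intra-block
coupling `k₀ ≥ 0`, constant block weight `w₀ > 0` and inter-block coupling `J ≥ 0` along `G`, the
block four-point Ursell function `U₄^τ` of `τₓ = w₀∑_l σ_{(x,l)}` satisfies
`|U₄^τ(u)| ≤ 2 N⁻³ w₀⁻⁴ ∑_z ∏ⱼ S^τ(uⱼ, z)`, `S^τ(a,a') = ∑_{l,l'} w₀² ⟨σ_{(a,l)}σ_{(a',l')}⟩`
(multilinearity, Lebowitz' sign, `PairIsing.abs_ursellFour_le_treeSum` for the constituents, and the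
exchangeability `block_avg_prod_mul_spinAt_eq`). [cite: AizenmanDuminilCopinAnnals2021, §7 (p. 28) and §7.1] -/
theorem block_abs_ursell_le {k₀ w₀ J : ℝ} (hk : 0 ≤ k₀) (hw : 0 < w₀) (hJ : 0 ≤ J) (hN : 0 < N)
    (u : Fin 4 → V) :
    let c : V × Fin N → V × Fin N → ℝ := fun a b => (if a.1 = b.1 then k₀ else (0 : ℝ)) +
      (if G.Adj a.1 b.1 then J / 2 * (w₀ * w₀) else 0)
    let S : V → V → ℝ := fun a a' => ∑ l : Fin N, ∑ l' : Fin N, w₀ * w₀ * PairIsing.avg c (spinPair (a, l) (a', l'))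
    |PairIsing.avg c (fun ρ => ∏ m, ∑ l, w₀ * (spinAt (u m, l) ρ : ℝ)) -
        S (u 0) (u 1) * S (u 2) (u 3) - S (u 0) (u 2) * S (u 1) (u 3) - S (u 0) (u 3) * S (u 1) (u 2)| ≤
      2 * (((N : ℝ) ^ 3)⁻¹ * (w₀ ^ 4)⁻¹) * ∑ z, ∏ j, S (u j) z := by
  intro c S
  have hc : ∀ a b : V × Fin N, 0 ≤ c a b := fun a b =>
    blockCoupling_nonneg G (K := fun _ _ => k₀) (w := fun _ => w₀) (fun _ _ => hk) (fun _ => hw.le) hJ a b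
  have hc' : ∀ a b : V × Fin N, a ≠ b → 0 ≤ c a b := fun a b _ => hc a b
  -- multilinearity and Lebowitz' sign
  have hmulti := PairIsing.block_ursell_eq_sum c (fun _ : Fin N => w₀) u
  have habs := PairIsing.abs_sum_prod_mul_ursellFour c hc' (w := fun _ : Fin N => w₀)
    (fun _ => hw.le) u
  -- the mixed correlations `A_j(z,l) = ⟨τ_{u_j} σ_{(z,l)}⟩ / w₀`-free form
  set A : Fin 4 → V → Fin N → ℝ := fun j z l =>
    ∑ L : Fin N, w₀ * PairIsing.avg c (spinPair (u j, L) (z, l)) with hA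
  have hAavg : ∀ j z l, A j z l =
      PairIsing.avg c (fun ρ => (∏ i : Fin 1, ∑ L, w₀ * (spinAt ((fun _ => u j) i, L) ρ : ℝ)) *
        spinAt (z, l) ρ) := by
    intro j z l
    rw [hA]
    simp only [Fin.prod_univ_one]
    have : (fun ρ : SpinConfig (V × Fin N) => (∑ L, w₀ * (spinAt (u j, L) ρ : ℝ)) * spinAt (z, l) ρ) =
        fun ρ => ∑ L, w₀ * spinPair (u j, L) (z, l) ρ := by
      funext ρ
      rw [Finset.sum_mul]
      refine Finset.sum_congr rfl fun L _ => ?_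
      rw [spinPair]; ring
    rw [this, PairIsing.avg_finset_sum]
    exact Finset.sum_congr rfl fun L _ => (PairIsing.avg_const_mul c _ _).symm
  have hAconst : ∀ j z l l', A j z l = A j z l' := fun j z l l' => by
    rw [hAavg, hAavg]
    exact block_avg_prod_mul_spinAt_eq G k₀ w₀ J z l l' _
  set l₀ : Fin N := ⟨0, hN⟩ with hl₀
  have hS : ∀ j z, S (u j) z = (N : ℝ) * w₀ * A j z l₀ := by
    intro j z
    show ∑ l : Fin N, ∑ l' : Fin N, w₀ * w₀ * PairIsing.avg c (spinPair (u j, l) (z, l')) = _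
    rw [Finset.sum_comm]
    have : ∀ l' : Fin N, ∑ l : Fin N, w₀ * w₀ * PairIsing.avg c (spinPair (u j, l) (z, l')) =
        w₀ * A j z l₀ := fun l' => by
      rw [hAconst j z l₀ l', hA]
      simp only
      rw [Finset.mul_sum]
      exact Finset.sum_congr rfl fun L _ => by ring
    simp_rw [this]
    rw [Finset.sum_const, Finset.card_univ, Fintype.card_fin, nsmul_eq_mul]
    ring
  -- assemble
  have hNw : (0 : ℝ) < (N : ℝ) * w₀ := mul_pos (by exact_mod_cast hN) hw
  calc |PairIsing.avg c (fun ρ => ∏ m, ∑ l, w₀ * (spinAt (u m, l) ρ : ℝ)) -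
          S (u 0) (u 1) * S (u 2) (u 3) - S (u 0) (u 2) * S (u 1) (u 3) - S (u 0) (u 3) * S (u 1) (u 2)|
      = ∑ L : Fin (2 * 2) → Fin N, (∏ m, (fun _ : Fin N => w₀) (L m)) *
          |PairIsing.ursellFour c (fun m => (u m, L m))| := by rw [← habs, ← hmulti]
    _ ≤ ∑ L : Fin (2 * 2) → Fin N, (∏ m, (fun _ : Fin N => w₀) (L m)) *
          (2 * ∑ v, ∏ j, PairIsing.avg c (spinPair ((fun m => (u m, L m)) j) v)) :=
        Finset.sum_le_sum fun L _ => mul_le_mul_of_nonneg_left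
          (PairIsing.abs_ursellFour_le_treeSum c hc _) (Finset.prod_nonneg fun _ _ => hw.le)
    _ = ∑ L : Fin (2 * 2) → Fin N, ∑ v : V × Fin N,
          2 * ∏ j, (w₀ * PairIsing.avg c (spinPair (u j, L j) v)) := by
        refine Finset.sum_congr rfl fun L _ => ?_
        rw [Finset.mul_sum, Finset.mul_sum]
        refine Finset.sum_congr rfl fun v _ => ?_
        simp only [Finset.prod_mul_distrib, Finset.prod_const, Finset.card_univ, Fintype.card_fin]
        ring
    _ = 2 * ∑ v : V × Fin N, ∑ L : Fin (2 * 2) → Fin N,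
          ∏ j, (w₀ * PairIsing.avg c (spinPair (u j, L j) v)) := by
        rw [Finset.sum_comm, Finset.mul_sum]
        refine Finset.sum_congr rfl fun v _ => ?_
        rw [Finset.mul_sum]
    _ = 2 * ∑ v : V × Fin N, ∏ j, A j v.1 v.2 := by
        congr 1
        refine Finset.sum_congr rfl fun v _ => ?_
        rw [hA]
        exact (Finset.prod_univ_sum (fun _ : Fin (2 * 2) => (Finset.univ : Finset (Fin N)))
          (fun j L => w₀ * PairIsing.avg c (spinPair (u j, L) v))).symm
    _ = 2 * ∑ z : V, ∑ l : Fin N, ∏ j, A j z l := by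
        rw [Fintype.sum_prod_type]
    _ = 2 * ∑ z : V, (N : ℝ) * ∏ j, A j z l₀ := by
        congr 1
        refine Finset.sum_congr rfl fun z _ => ?_
        have : ∀ l, ∏ j, A j z l = ∏ j, A j z l₀ := fun l =>
          Finset.prod_congr rfl fun j _ => hAconst j z l l₀
        simp_rw [this]
        rw [Finset.sum_const, Finset.card_univ, Fintype.card_fin, nsmul_eq_mul]
    _ = 2 * (((N : ℝ) ^ 3)⁻¹ * (w₀ ^ 4)⁻¹) * ∑ z, ∏ j, S (u j) z := by
        have hw0 : w₀ ≠ 0 := hw.ne'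
        have hN0 : (N : ℝ) ≠ 0 := by exact_mod_cast hN.ne'
        have key : ((N : ℝ) ^ 3)⁻¹ * (w₀ ^ 4)⁻¹ * ((N : ℝ) * w₀) ^ 4 = N := by
          rw [mul_pow, show ((N : ℝ) ^ 3)⁻¹ * (w₀ ^ 4)⁻¹ * ((N : ℝ) ^ 4 * w₀ ^ 4) =
            (((N : ℝ) ^ 3)⁻¹ * (N : ℝ) ^ 4) * ((w₀ ^ 4)⁻¹ * w₀ ^ 4) by ring,
            inv_mul_cancel₀ (pow_ne_zero 4 hw0), mul_one, show (N : ℝ) ^ 4 = (N : ℝ) ^ 3 * N by ring,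
            ← mul_assoc, inv_mul_cancel₀ (pow_ne_zero 3 hN0), one_mul]
        rw [Finset.mul_sum, Finset.mul_sum]
        refine Finset.sum_congr rfl fun z _ => ?_
        have hprod : ∏ j, S (u j) z = ((N : ℝ) * w₀) ^ 4 * ∏ j, A j z l₀ := by
          simp_rw [hS]
          rw [Finset.prod_mul_distrib, Finset.prod_const, Finset.card_univ, Fintype.card_fin]
        rw [hprod, show 2 * (((N : ℝ) ^ 3)⁻¹ * (w₀ ^ 4)⁻¹) * (((N : ℝ) * w₀) ^ 4 * ∏ j, A j z l₀) =
          2 * ((((N : ℝ) ^ 3)⁻¹ * (w₀ ^ 4)⁻¹ * ((N : ℝ) * w₀) ^ 4) * ∏ j, A j z l₀) by ring, key]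

end Blocks

/-! ### Part 3. The Simon–Griffiths approximants, explicitly -/

section Approximants

variable {V : Type*} [Fintype V] (G : SimpleGraph V) [DecidableRel G.Adj]

/-- Everything is integrable against a finite magnetization law (a finite mixture of Dirac masses;
as the private lemma of `GriffithsSimonApproximation`). [folklore] -/
theorem integrable_isingMagnetizationLaw_of_stronglyMeasurable {n : ℕ} (K : Fin n → Fin n → ℝ)
    (w : Fin n → ℝ) {f : ℝ → ℝ} (hf : StronglyMeasurable f) :
    Integrable f (isingMagnetizationLaw n K w : Measure ℝ) := by
  have hmeas := measurable_of_config (weightedMagnetization w)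
  change Integrable f ((isingPairPMF K).map (weightedMagnetization w)).toMeasure
  rw [← PMF.toMeasure_map (weightedMagnetization w) (isingPairPMF K) hmeas,
    integrable_map_measure hf.aestronglyMeasurable hmeas.aemeasurable]
  exact Integrable.of_finite

/-- **The Simon–Griffiths block Ising approximation of `phi4Measure`, with explicit uniform data**
(the approximants of `isIsingLimitLaw_phi4_holds`, cf. `exists_blockIsing_tendsto_integral_phi4Measure`
where they are hidden behind an existential): there are `M_k → ∞` (`M_k ≥ 2`) such that the Curie–Weiss
blocks of `N_k = M_k⁴` constituent spins with the CONSTANT pair coupling `γ_k/M_k⁴ ≥ 0`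
(`γ_k = SimonGriffiths.gamma g κ M_k`) and the CONSTANT block weight `SimonGriffiths.mesh g M_k =
scale(g)/M_k³`, coupled along `G` with strength `J`, converge to `phi4Measure G g κ J` on every continuous
observable of Gaussian-exponential growth. [cite: SimonGriffiths1973, §2 Thm. 1] [cite: AizenmanDuminilCopinAnnals2021, §2 (p. 7, last paragraph)] -/
theorem exists_uniformBlockIsing_tendsto_integral_phi4Measure {g : ℝ} (hg : 0 < g) (κ J : ℝ) :
    ∃ M : ℕ → ℕ, (∀ k, 2 ≤ M k) ∧ (∀ k, 0 ≤ SimonGriffiths.gamma g κ (M k)) ∧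
      ∀ (F : (V → ℝ) → ℝ), Continuous F → ∀ C b : ℝ,
        (∀ φ, |F φ| ≤ C * Real.exp (b * ∑ x, φ x ^ 2)) →
        Tendsto (fun k => ∫ φ, F φ ∂(latticeFieldMeasure G
            (isingMagnetizationLaw (M k ^ 4)
              (fun _ _ => SimonGriffiths.gamma g κ (M k) / ((M k : ℕ) : ℝ) ^ 4)
              (fun _ => SimonGriffiths.mesh g (M k)) : Measure ℝ) J)) atTop
          (𝓝 (∫ φ, F φ ∂(phi4Measure G g κ J))) := by
  set M : ℕ → ℕ := fun k => k + (⌈2 * |SimonGriffiths.beta g κ|⌉₊ + 2) with hM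
  have hM2 : ∀ k, 2 ≤ M k := fun k => by simp only [hM]; omega
  have hM0 : ∀ k, M k ≠ 0 := fun k => by have := hM2 k; omega
  refine ⟨M, hM2, fun k => SimonGriffiths.gamma_shift_nonneg g κ k, fun F hF C b hFb => ?_⟩
  have hint : Integrable (fun u : ℝ => Real.exp (-g * u ^ 4 - κ * u ^ 2)) :=
    SimonGriffiths.integrable_phi4Density hg κ
  haveI := isProbabilityMeasure_phi4SiteLaw hg κ
  set ν₀ : ProbabilityMeasure ℝ :=
    ⟨(volume : Measure ℝ).tilted fun u => -g * u ^ 4 - κ * u ^ 2, this⟩ with hν₀_def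
  have hν₀ : (ν₀ : Measure ℝ) = (∫⁻ u, ENNReal.ofReal (Real.exp (-g * u ^ 4 - κ * u ^ 2)))⁻¹ •
      volume.withDensity (fun u => ENNReal.ofReal (Real.exp (-g * u ^ 4 - κ * u ^ 2))) :=
    tilted_eq_smul_withDensity volume hint
  set ν : ℕ → ProbabilityMeasure ℝ := fun k => isingMagnetizationLaw (M k ^ 4)
      (fun _ _ => SimonGriffiths.gamma g κ (M k) / ((M k : ℕ) : ℝ) ^ 4)
      (fun _ => SimonGriffiths.mesh g (M k)) with hν
  have hlim : Tendsto ν atTop (𝓝 ν₀) := by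
    rw [ProbabilityMeasure.tendsto_iff_forall_integral_tendsto]
    intro f
    have hb : ∀ u, |f u| ≤ ‖f‖ * Real.exp (0 * u ^ 2) := fun u => by
      simpa using f.norm_coe_le_norm u
    have hlat := (SimonGriffiths.tendsto_latticeAverage hg κ f.continuous hb).comp
      (tendsto_add_atTop_nat ((⌈2 * |SimonGriffiths.beta g κ|⌉₊ + 2)))
    rw [SimonGriffiths.integral_phi4Law hg κ hν₀]
    refine hlat.congr fun k => ?_
    simp only [Function.comp_def]
    exact (SimonGriffiths.integral_cwLaw g κ (hM0 k) f.continuous).symm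
  have hmom : ∀ b₂ : ℝ, ∃ C : ℝ, ∀ k, Integrable (fun u => Real.exp (b₂ * u ^ 2)) (ν k : Measure ℝ) ∧
      ∫ u, Real.exp (b₂ * u ^ 2) ∂(ν k : Measure ℝ) ≤ C := by
    intro b₂
    have hb : ∀ u, |Real.exp (b₂ * u ^ 2)| ≤ 1 * Real.exp (b₂ * u ^ 2) := fun u => by
      rw [abs_of_pos (Real.exp_pos _), one_mul]
    have hlat := (SimonGriffiths.tendsto_latticeAverage hg κ (φ := fun u => Real.exp (b₂ * u ^ 2))
      (by fun_prop) hb).comp (tendsto_add_atTop_nat ((⌈2 * |SimonGriffiths.beta g κ|⌉₊ + 2)))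
    obtain ⟨C, hC⟩ := hlat.bddAbove_range
    refine ⟨C, fun k => ⟨integrable_isingMagnetizationLaw_of_stronglyMeasurable _ _
      (by fun_prop : Continuous fun u : ℝ => Real.exp (b₂ * u ^ 2)).stronglyMeasurable, hC ⟨k, ?_⟩⟩⟩
    simp only [Function.comp_def]
    exact (SimonGriffiths.integral_cwLaw g κ (hM0 k)
      (φ := fun u => Real.exp (b₂ * u ^ 2)) (by fun_prop)).symm
  have h := tendsto_integral_latticeFieldMeasure G hlim hmom J hF hFb
  rwa [show latticeFieldMeasure G (ν₀ : Measure ℝ) J = phi4Measure G g κ J from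
    latticeFieldMeasure_phi4SiteLaw G hg κ J] at h

/-- The Simon–Griffiths normalisation: `N⁻³ w⁻⁴ = 12 g` for `N = M⁴` and `w = scale(g)/M³`. [cite: SimonGriffiths1973, §2 Thm. 1] -/
theorem simonGriffiths_blockConstant {g : ℝ} (hg : 0 < g) {M : ℕ} (hM : M ≠ 0) :
    (((M ^ 4 : ℕ) : ℝ) ^ 3)⁻¹ * ((SimonGriffiths.mesh g M) ^ 4)⁻¹ = 12 * g := by
  have hM0 : ((M : ℕ) : ℝ) ≠ 0 := by exact_mod_cast hM
  have hs : SimonGriffiths.scale g ^ 4 = (12 * g)⁻¹ := SimonGriffiths.scale_pow_four hg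
  have hg0 : (12 * g) ≠ 0 := by positivity
  unfold SimonGriffiths.mesh
  rw [div_pow, hs]
  push_cast
  rw [← mul_inv, inv_eq_iff_eq_inv]
  field_simp

end Approximants

/-! ### Part 4. Graph measures: block Ising laws and the lattice `φ⁴` measure -/

section GraphMeasures

variable {V : Type} [Fintype V] [DecidableEq V] (G : SimpleGraph V) [DecidableRel G.Adj]

/-- **The tree diagram bound for the uniform block Ising lattice laws**
`latticeFieldMeasure G (isingMagnetizationLaw N (fun _ _ => k₀) (fun _ => w₀)) J` (`0 < N`, `k₀ ≥ 0`,
`w₀ > 0`, `J ≥ 0`): `|U₄(u)| ≤ 2 N⁻³w₀⁻⁴ ∑_z ∏ⱼ S₂(uⱼ,z)` for the coordinate field, through the dictionary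
`integral_latticeFieldMeasure_isingMagnetizationLaw_eq_avg` and `block_abs_ursell_le`.
[cite: AizenmanDuminilCopinAnnals2021, §7 (p. 28)] -/
theorem blockIsing_treeDiagramBound {N : ℕ} (hN : 0 < N) {k₀ w₀ J : ℝ} (hk : 0 ≤ k₀) (hw : 0 < w₀)
    (hJ : 0 ≤ J) (u : Fin 4 → V) :
    |connectedFour (latticeFieldMeasure G
        (isingMagnetizationLaw N (fun _ _ => k₀) (fun _ => w₀) : Measure ℝ) J)
        (fun (a : V) (φ : V → ℝ) => φ a) u| ≤
      2 * (((N : ℝ) ^ 3)⁻¹ * (w₀ ^ 4)⁻¹) *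
        ∑ z, ∏ j, Literature.Probability.LatticeModels.twoPoint (latticeFieldMeasure G
          (isingMagnetizationLaw N (fun _ _ => k₀) (fun _ => w₀) : Measure ℝ) J)
          (fun (a : V) (φ : V → ℝ) => φ a) (u j) z := by
  classical
  set μ := latticeFieldMeasure G (isingMagnetizationLaw N (fun _ _ => k₀) (fun _ => w₀) : Measure ℝ) J
    with hμ
  set c : V × Fin N → V × Fin N → ℝ := fun a b => (if a.1 = b.1 then k₀ else (0 : ℝ)) +
    (if G.Adj a.1 b.1 then J / 2 * (w₀ * w₀) else 0) with hc_def
  have hnP : ∀ {m : ℕ} (y : Fin m → V), nPoint μ (fun (a : V) (φ : V → ℝ) => φ a) y =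
      PairIsing.avg c (fun ρ => ∏ i, ∑ l, w₀ * (spinAt (y i, l) ρ : ℝ)) := fun y => by
    unfold nPoint
    exact integral_latticeFieldMeasure_isingMagnetizationLaw_eq_avg G (fun _ _ => k₀) (fun _ => w₀) J
      (by fun_prop)
  have h2 : ∀ a b : V, Literature.Probability.LatticeModels.twoPoint μ (fun (a : V) (φ : V → ℝ) => φ a) a b =
      ∑ l, ∑ l', w₀ * w₀ * PairIsing.avg c (spinPair (a, l) (b, l')) := fun a b => by
    unfold Literature.Probability.LatticeModels.twoPoint
    rw [integral_latticeFieldMeasure_isingMagnetizationLaw_eq_avg G (fun _ _ => k₀) (fun _ => w₀) J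
      (by fun_prop)]
    have hexp : ∀ ρ : SpinConfig (V × Fin N),
        (∑ i, w₀ * (spinAt (a, i) ρ : ℝ)) * ∑ i, w₀ * (spinAt (b, i) ρ : ℝ) =
          ∑ l, ∑ l', w₀ * w₀ * spinPair (a, l) (b, l') ρ := fun ρ => by
      rw [Finset.sum_mul_sum]
      refine Finset.sum_congr rfl fun l _ => Finset.sum_congr rfl fun l' _ => ?_
      rw [spinPair]
      ring
    show PairIsing.avg c (fun ρ => (∑ i, w₀ * (spinAt (a, i) ρ : ℝ)) * ∑ i, w₀ * (spinAt (b, i) ρ : ℝ)) = _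
    simp_rw [hexp]
    rw [PairIsing.avg_finset_sum]
    refine Finset.sum_congr rfl fun l _ => ?_
    rw [PairIsing.avg_finset_sum]
    exact Finset.sum_congr rfl fun l' _ => PairIsing.avg_const_mul c _ _
  have hU : connectedFour μ (fun (a : V) (φ : V → ℝ) => φ a) u =
      PairIsing.avg c (fun ρ => ∏ m, ∑ l, w₀ * (spinAt (u m, l) ρ : ℝ)) -
        (∑ l : Fin N, ∑ l' : Fin N, w₀ * w₀ * PairIsing.avg c (spinPair (u 0, l) (u 1, l'))) *
          (∑ l : Fin N, ∑ l' : Fin N, w₀ * w₀ * PairIsing.avg c (spinPair (u 2, l) (u 3, l'))) -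
        (∑ l : Fin N, ∑ l' : Fin N, w₀ * w₀ * PairIsing.avg c (spinPair (u 0, l) (u 2, l'))) *
          (∑ l : Fin N, ∑ l' : Fin N, w₀ * w₀ * PairIsing.avg c (spinPair (u 1, l) (u 3, l'))) -
        (∑ l : Fin N, ∑ l' : Fin N, w₀ * w₀ * PairIsing.avg c (spinPair (u 0, l) (u 3, l'))) *
          (∑ l : Fin N, ∑ l' : Fin N, w₀ * w₀ * PairIsing.avg c (spinPair (u 1, l) (u 2, l'))) := by
    rw [connectedFour, hnP u, h2, h2, h2, h2, h2, h2]
  have hT : ∀ z, ∏ j, Literature.Probability.LatticeModels.twoPoint μ (fun (a : V) (φ : V → ℝ) => φ a) (u j) z =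
      ∏ j, ∑ l : Fin N, ∑ l' : Fin N, w₀ * w₀ * PairIsing.avg c (spinPair (u j, l) (z, l')) :=
    fun z => Finset.prod_congr rfl fun j _ => h2 _ _
  rw [hU]
  simp_rw [hT]
  exact block_abs_ursell_le G hk hw hJ hN u

omit [DecidableEq V] in
/-- **The tree diagram bound for the lattice `φ⁴` measure on a finite graph.** For `g > 0`, real `κ`,
`J ≥ 0` and any four sites `u` (coincidences allowed),
`|U₄^{g,κ,J}(u)| ≤ 24 g ∑_z ∏ⱼ ⟨φ_{uⱼ}φ_z⟩_{g,κ,J}` under `phi4Measure G g κ J`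
(`U₄ = connectedFour`): Aizenman's tree diagram bound (1982, Prop. 5.3) transferred through the
Simon–Griffiths block Ising approximants along Aizenman–Duminil-Copin 2021, §7 — for the
approximants `blockIsing_treeDiagramBound` with `2N⁻³w⁻⁴ = 24 g` (`simonGriffiths_blockConstant`),
then the limit (`exists_uniformBlockIsing_tendsto_integral_phi4Measure`). The shape is that of the
first-order skeleton inequality of Brydges–Fröhlich–Sokal 1983 for lattice `φ⁴`.
[cite: AizenmanCMP1982, Prop. 5.3 with §12] [cite: AizenmanDuminilCopinAnnals2021, §7 (p. 28) and §7.1] -/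
theorem phi4_treeDiagramBound {g : ℝ} (hg : 0 < g) (κ : ℝ) {J : ℝ} (hJ : 0 ≤ J) (u : Fin 4 → V) :
    |connectedFour (phi4Measure G g κ J) (fun (a : V) (φ : V → ℝ) => φ a) u| ≤
      24 * g * ∑ z, ∏ j, Literature.Probability.LatticeModels.twoPoint (phi4Measure G g κ J)
        (fun (a : V) (φ : V → ℝ) => φ a) (u j) z := by
  classical
  obtain ⟨M, hM2, hγ, hlim⟩ := exists_uniformBlockIsing_tendsto_integral_phi4Measure G hg κ J
  set μk : ℕ → Measure (V → ℝ) := fun k => latticeFieldMeasure G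
    (isingMagnetizationLaw (M k ^ 4) (fun _ _ => SimonGriffiths.gamma g κ (M k) / ((M k : ℕ) : ℝ) ^ 4)
      (fun _ => SimonGriffiths.mesh g (M k)) : Measure ℝ) J with hμk
  set μ := phi4Measure G g κ J with hμ
  have hnP : ∀ {m : ℕ} (y : Fin (2 * m) → V),
      Tendsto (fun k => nPoint (μk k) (fun (a : V) (φ : V → ℝ) => φ a) y) atTop
        (𝓝 (nPoint μ (fun (a : V) (φ : V → ℝ) => φ a) y)) := fun {m} y =>
    hlim (fun φ => ∏ i, φ (y i)) (by fun_prop) _ _ (abs_prod_apply_le m y)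
  have h2 : ∀ a b : V, Tendsto (fun k =>
      Literature.Probability.LatticeModels.twoPoint (μk k) (fun (a : V) (φ : V → ℝ) => φ a) a b) atTop
      (𝓝 (Literature.Probability.LatticeModels.twoPoint μ (fun (a : V) (φ : V → ℝ) => φ a) a b)) :=
    fun a b => hlim (fun φ => φ a * φ b) (by fun_prop) 1 1 (fun φ => by
      have ha := Finset.single_le_sum (fun y _ => sq_nonneg (φ y)) (Finset.mem_univ a)
      have hb := Finset.single_le_sum (fun y _ => sq_nonneg (φ y)) (Finset.mem_univ b)
      rw [abs_mul, one_mul, one_mul]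
      nlinarith [abs_nonneg (φ a), abs_nonneg (φ b), sq_abs (φ a), sq_abs (φ b),
        Real.add_one_le_exp (∑ y, φ y ^ 2), sq_nonneg (|φ a| - |φ b|)])
  have h4 : Tendsto (fun k => connectedFour (μk k) (fun (a : V) (φ : V → ℝ) => φ a) u)
      atTop (𝓝 (connectedFour μ (fun (a : V) (φ : V → ℝ) => φ a) u)) := by
    unfold connectedFour
    exact (((hnP (m := 2) u).sub ((h2 _ _).mul (h2 _ _))).sub ((h2 _ _).mul (h2 _ _))).sub
      ((h2 _ _).mul (h2 _ _))
  have hT : Tendsto (fun k => 24 * g * ∑ z, ∏ j,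
      Literature.Probability.LatticeModels.twoPoint (μk k) (fun (a : V) (φ : V → ℝ) => φ a) (u j) z)
      atTop (𝓝 (24 * g * ∑ z, ∏ j,
        Literature.Probability.LatticeModels.twoPoint μ (fun (a : V) (φ : V → ℝ) => φ a) (u j) z)) :=
    (tendsto_finsetSum _ fun z _ => tendsto_finsetProd _ fun j _ => h2 (u j) z).const_mul _
  refine le_of_tendsto_of_tendsto' h4.abs hT fun k => ?_
  have hMk : M k ≠ 0 := by have := hM2 k; omega
  have hb := blockIsing_treeDiagramBound G (N := M k ^ 4) (by positivity)
    (k₀ := SimonGriffiths.gamma g κ (M k) / ((M k : ℕ) : ℝ) ^ 4) (w₀ := SimonGriffiths.mesh g (M k))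
    (div_nonneg (hγ k) (by positivity)) (SimonGriffiths.mesh_pos hg hMk) hJ u
  rw [simonGriffiths_blockConstant hg hMk, show (2 : ℝ) * (12 * g) = 24 * g by ring] at hb
  exact hb

end GraphMeasures

/-! ### Part 5. Free-boundary volumes of `ℤᵈ` -/

section Zd

variable (d : ℕ)

/-- **The tree diagram bound for the free-boundary lattice `φ⁴` measures on `ℤᵈ`.** For `g > 0`,
`J ≥ 0`, a finite volume `Λ` and four points of `Λ`:
`|U₄^Λ(u)| ≤ 24 g ∑_{z ∈ Λ} ∏ⱼ S₂^Λ(uⱼ,z)` with `S₂^Λ = phi4TwoPointIn d Λ g κ J`,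
`U₄^Λ = connectedFour (phi4FreeMeasure d Λ g κ J)` (`phi4_treeDiagramBound` on the graph `↥Λ`,
transported by `glueZero`). [cite: AizenmanCMP1982, Prop. 5.3 with §12] [cite: AizenmanDuminilCopinAnnals2021, §7 (p. 28)] -/
theorem phi4Free_treeDiagramBound (Λ : Finset (Site d)) {g : ℝ} (hg : 0 < g) (κ : ℝ) {J : ℝ}
    (hJ : 0 ≤ J) (u : Fin 4 → Site d) (hu : ∀ j, u j ∈ Λ) :
    |connectedFour (phi4FreeMeasure d Λ g κ J) (fun (z : Site d) (φ : Site d → ℝ) => φ z) u| ≤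
      24 * g * ∑ z ∈ Λ, ∏ j, phi4TwoPointIn d Λ g κ J (u j) z := by
  classical
  set μg := phi4Measure (zdGraphIn d Λ) g κ J with hμg
  set u' : Fin 4 → Λ := fun j => ⟨u j, hu j⟩ with hu'
  have h2 : ∀ {x y : Site d} (hx : x ∈ Λ) (hy : y ∈ Λ), phi4TwoPointIn d Λ g κ J x y =
      Literature.Probability.LatticeModels.twoPoint μg (fun (a : Λ) (ψ : Λ → ℝ) => ψ a) ⟨x, hx⟩ ⟨y, hy⟩ :=
    fun hx hy => phi4TwoPointIn_eq_of_mem d Λ g κ J hx hy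
  have hc4 : connectedFour (phi4FreeMeasure d Λ g κ J) (fun (z : Site d) (φ : Site d → ℝ) => φ z) u =
      connectedFour μg (fun (a : Λ) (ψ : Λ → ℝ) => ψ a) u' := by
    unfold connectedFour
    rw [nPoint_phi4FreeMeasure_eq_of_mem d Λ g κ J u hu]
    have ht : ∀ i j : Fin 4, Literature.Probability.LatticeModels.twoPoint (phi4FreeMeasure d Λ g κ J)
        (fun (z : Site d) (φ : Site d → ℝ) => φ z) (u i) (u j) =
        Literature.Probability.LatticeModels.twoPoint μg (fun (a : Λ) (ψ : Λ → ℝ) => ψ a) (u' i) (u' j) :=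
      fun i j => h2 (hu i) (hu j)
    rw [ht, ht, ht, ht, ht, ht]
  have hS : ∑ z ∈ Λ, ∏ j, phi4TwoPointIn d Λ g κ J (u j) z =
      ∑ z : Λ, ∏ j, Literature.Probability.LatticeModels.twoPoint μg (fun (a : Λ) (ψ : Λ → ℝ) => ψ a) (u' j) z := by
    rw [← Finset.sum_coe_sort Λ]
    refine Finset.sum_congr rfl fun z _ => Finset.prod_congr rfl fun j _ => ?_
    exact h2 (hu j) z.2
  rw [hc4, hS]
  exact phi4_treeDiagramBound (zdGraphIn d Λ) hg κ hJ u'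

/-- **The same in the box vocabulary** (`phi4BoxMeasure d R`, `phi4TwoPointBox d R`): for all `R` and
`u ∈ (Λ_R)⁴`, `|U₄^R(u)| ≤ 24 g ∑_{z ∈ Λ_R} ∏ⱼ S₂^R(uⱼ,z)` — the starting point ("tree diagram bound")
of the estimates behind the hypothesis `hU` of
`Literature.MathematicalPhysics.QuantumFieldTheory.phi44_triviality_of_ursellFourSum` and
`phi4_highDim_triviality_of_ursellFourSum`. [cite: AizenmanCMP1982, Prop. 5.3 with §12] -/
theorem phi4Box_treeDiagramBound {g : ℝ} (hg : 0 < g) (κ : ℝ) {J : ℝ} (hJ : 0 ≤ J) (R : ℕ)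
    (u : Fin 4 → Site d) (hu : ∀ j, u j ∈ box d R) :
    |connectedFour (phi4BoxMeasure d R g κ J) (fun (z : Site d) (φ : Site d → ℝ) => φ z) u| ≤
      24 * g * ∑ z ∈ box d R, ∏ j, phi4TwoPointBox d R g κ J (u j) z :=
  phi4Free_treeDiagramBound d (box d R) hg κ hJ u hu

/-- **The summed tree diagram bound** (the form in which it enters the `U₄`-smallness estimates, e.g.
Aizenman 1982, §13, or Aizenman–Duminil-Copin 2021, §6.3 "bounds on (1)–(4)"): for `Λ' ⊆ Λ_R`,
`∑_{u ∈ Λ'⁴} |U₄^R(u)| ≤ 24 g ∑_{z ∈ Λ_R} (∑_{x ∈ Λ'} S₂^R(x,z))⁴`. [cite: AizenmanCMP1982, Prop. 5.3 with §12–13] -/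
theorem phi4Box_ursellFourSum_le_treeSum {g : ℝ} (hg : 0 < g) (κ : ℝ) {J : ℝ} (hJ : 0 ≤ J) (R : ℕ)
    {Λ' : Finset (Site d)} (hΛ' : Λ' ⊆ box d R) :
    ∑ u ∈ Fintype.piFinset (fun _ : Fin 4 => Λ'),
        |connectedFour (phi4BoxMeasure d R g κ J) (fun (z : Site d) (φ : Site d → ℝ) => φ z) u| ≤
      24 * g * ∑ z ∈ box d R, (∑ x ∈ Λ', phi4TwoPointBox d R g κ J x z) ^ 4 := by
  calc ∑ u ∈ Fintype.piFinset (fun _ : Fin 4 => Λ'),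
        |connectedFour (phi4BoxMeasure d R g κ J) (fun (z : Site d) (φ : Site d → ℝ) => φ z) u|
      ≤ ∑ u ∈ Fintype.piFinset (fun _ : Fin 4 => Λ'),
          24 * g * ∑ z ∈ box d R, ∏ j, phi4TwoPointBox d R g κ J (u j) z :=
        Finset.sum_le_sum fun u hu => phi4Box_treeDiagramBound d hg κ hJ R u
          fun j => hΛ' (Fintype.mem_piFinset.1 hu j)
    _ = 24 * g * ∑ z ∈ box d R, ∑ u ∈ Fintype.piFinset (fun _ : Fin 4 => Λ'),
          ∏ j, phi4TwoPointBox d R g κ J (u j) z := by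
        rw [← Finset.mul_sum, Finset.sum_comm]
    _ = 24 * g * ∑ z ∈ box d R, (∑ x ∈ Λ', phi4TwoPointBox d R g κ J x z) ^ 4 := by
        congr 1
        refine Finset.sum_congr rfl fun z _ => ?_
        rw [← Finset.prod_univ_sum (fun _ : Fin 4 => Λ') (fun j x => phi4TwoPointBox d R g κ J x z),
          Finset.prod_const, Finset.card_univ, Fintype.card_fin]

end Zd

end Literature.MathematicalPhysics.QuantumLattice
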